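import Literature.InformationTheory.QuantumCodes.StabilizerCodeDimension
import Literature.InformationTheory.QuantumCodes.StabilizerDistance
import HarnessLib

/-!
# CRSS Theorem 1: an `[[n, k, d]]` additive code is a `2^k`-dimensional quantum code correcting `⌊(d−1)/2⌋` errors

Venture QEC (cell `qec`, PARTITION row 03 × lit-1's `SymplecticCodes.lean`; known mathematics).
Calderbank–Rains–Shor–Sloane, *Quantum error correction via codes over GF(4)*, Theorem 1
(printed p. 4): "Suppose `S̄` is an `(n − k)`-dimensional linear subspace of `Ē` which is contained
in its dual `S̄⊥` …, and is such that there are no vectors of weight `≤ d − 1` in `S̄⊥ ∖ S̄`. Then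
there is a quantum-error-correcting code mapping `k` qubits to `n` qubits which can correct
`[(d − 1)/2]` errors." In the tree `S̄` with these properties is lit-1's `IsAdditiveCode S k d`; the
quantum code is the stabilizer code `codeSpace (signedGenOps gen s)` of ANY linearly independent
rows `gen` spanning `S̄` and ANY signs `s` (`StabilizerErrorCorrection.lean`), and this file proves
both halves of the conclusion:

* `finrank_codeSpace_eq_two_pow` / `IsAdditiveCode.finrank_codeSpace` — it "maps `k` qubits to `n`
  qubits": `dim = 2^k` (from `2^r · dim = 2^n`, `StabilizerCodeDimension.lean`, i.e. NC Prop. 10.5;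
  CRSS p. 6: "each eigenspace must have the same dimension, namely `2^k`");
* `IsAdditiveCode.isCorrectable_of_sympWeight_le` — it "can correct `[(d−1)/2]` errors": every
  family of Pauli errors of weight `≤ t`, `2t < d`, is a correctable set of errors in the sense of
  the Knill–Laflamme theorem (`IsCorrectable`, NC Thm 10.1) — CRSS Lemma 1 (p. 6) via NC Thm 10.8;
* `IsAdditiveCode.exists_rows` — an `(n−k)`-dimensional `S̄` has `n − k` independent spanning rows
  (a basis), so the statements above are not vacuous;
* **`isCorrectable_toOperator_iff_of_linearIndependent`** / `IsAdditiveCode.isCorrectable_iff` —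
  CRSS Lemma 1 as an EQUIVALENCE ("can correct Σ precisely when `ē₁⁻¹ē₂ ∉ S̄⊥ ∖ S̄`"; Gottesman
  §3.2 "iff"): the 'only if' direction combines the necessity half of the Knill–Laflamme theorem
  with the detection criterion of `StabilizerDetection.lean`/`StabilizerCodeDimension.lean`;
* the same two conclusions in type-02's numerical vocabulary (`StabilizerDistance.lean`):
  `finrank_codeSpace_eq_two_pow_logicalDim` (`dim V_S = 2^{logicalDim S̄}`) and
  `isCorrectable_toOperator_of_lt_minDistance` (`2t < minDistance S̄` ⇒ weight-`≤ t` Pauli families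
  correctable).

## References
* [CalderbankEtAl1998] A. R. Calderbank, E. M. Rains, P. W. Shor, N. J. A. Sloane, IEEE Trans.
  Inform. Theory 44 (1998) 1369–1387 = arXiv:quant-ph/9608006, §2 Theorem 1 (printed p. 4),
  Lemma 1 and the dimension count (printed p. 6) — read via `lit read arxiv:quant-ph/9608006`
  (pp. 5, 7–8 of the arXiv file).
* [NielsenChuang2010] §10.5.1 Prop. 10.5; §10.5.5 Thm 10.8.
-/

noncomputable section

namespace Literature.InformationTheory.QuantumCodes

open Matrix Literature.Computability.QuantumComplexity
open scoped ComplexOrder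

variable {n r k d : ℕ}

/-- **`dim V_S = 2^k`** for `r` independent commuting rows on `n = r + k` qubits (any signs).
[cite: CalderbankEtAl1998, §2 (printed p. 6: "each eigenspace must have the same dimension, namely 2^k")]
[cite: NielsenChuang2010, §10.5.1 Prop. 10.5] -/
theorem finrank_codeSpace_eq_two_pow {gen : Fin r → SympVec n}
    (hS : IsSelfOrthogonal (Submodule.span (ZMod 2) (Set.range gen)))
    (hli : LinearIndependent (ZMod 2) gen) (hrk : r + k = n) (s : Fin r → ZMod 2) :
    Module.finrank ℂ (codeSpace (signedGenOps gen s)) = 2 ^ k := by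
  have h := two_pow_mul_finrank_codeSpace hS hli s
  have h2 : (2 : ℕ) ^ n = 2 ^ r * 2 ^ k := by rw [← hrk, pow_add]
  rw [h2] at h
  exact Nat.eq_of_mul_eq_mul_left (Nat.pos_of_ne_zero (pow_ne_zero r two_ne_zero)) h

/-- An `[[n,k,d]]` additive code `S̄` (lit-1's `IsAdditiveCode`) has `n − k` linearly independent
rows spanning it (a basis of the `(n−k)`-dimensional space `S̄`).
[cite: CalderbankEtAl1998, §2 Thm. 1 (printed p. 4: "an (n − k)-dimensional linear subspace of Ē")] -/
theorem IsAdditiveCode.exists_rows {S : Submodule (ZMod 2) (SympVec n)} (hS : IsAdditiveCode S k d) :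
    ∃ gen : Fin (n - k) → SympVec n,
      LinearIndependent (ZMod 2) gen ∧ Submodule.span (ZMod 2) (Set.range gen) = S := by
  have hrank : Module.finrank (ZMod 2) S = n - k := by have := hS.2.1; omega
  let b := Module.finBasisOfFinrankEq (ZMod 2) S hrank
  refine ⟨fun i => (b i : SympVec n), ?_, ?_⟩
  · exact b.linearIndependent.map' S.subtype (Submodule.ker_subtype S)
  · have h := congr_arg (Submodule.map S.subtype) b.span_eq
    rw [Submodule.map_span, Submodule.map_top, Submodule.range_subtype, ← Set.range_comp] at h
    exact h

/-- **CRSS Theorem 1, dimension half**: the stabilizer code of any independent rows spanning an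
`[[n,k,d]]` additive code `S̄` (any signs) has dimension `2^k` — "a quantum-error-correcting code
mapping `k` qubits to `n` qubits". (proved) [cite: CalderbankEtAl1998, §2 Thm. 1 (printed p. 4) and p. 6] -/
theorem IsAdditiveCode.finrank_codeSpace {S : Submodule (ZMod 2) (SympVec n)} (hS : IsAdditiveCode S k d)
    {gen : Fin r → SympVec n} (hli : LinearIndependent (ZMod 2) gen)
    (hspan : Submodule.span (ZMod 2) (Set.range gen) = S) (s : Fin r → ZMod 2) :
    Module.finrank ℂ (codeSpace (signedGenOps gen s)) = 2 ^ k := by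
  obtain ⟨hso, hdim, -, -⟩ := hS
  have hr : r = Module.finrank (ZMod 2) S := by
    rw [← hspan, finrank_span_eq_card hli, Fintype.card_fin]
  refine finrank_codeSpace_eq_two_pow (hspan ▸ hso) hli ?_ s
  omega

/-- **CRSS Theorem 1, correction half** (with Lemma 1): the stabilizer code of rows spanning an
`[[n,k,d]]` additive code `S̄` (any signs) corrects every family of Pauli errors `E(e_j)` of weight
`≤ t` whenever `2t < d` — it "can correct `[(d − 1)/2]` errors"; correction in the sense of the
Knill–Laflamme theorem (`IsCorrectable`: a trace-preserving recovery `ℛ` with `ℛ(ℰ(PρP)) ∝ PρP`).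
(proved) [cite: CalderbankEtAl1998, §2 Thm. 1 (printed p. 4) and Lemma 1 (printed p. 6)] -/
theorem IsAdditiveCode.isCorrectable_of_sympWeight_le {S : Submodule (ZMod 2) (SympVec n)}
    (hS : IsAdditiveCode S k d) {gen : Fin r → SympVec n}
    (hspan : Submodule.span (ZMod 2) (Set.range gen) = S) (s : Fin r → ZMod 2) {ι : Type*} [Fintype ι]
    {e : ι → SympVec n} {t : ℕ} (ht : 2 * t < d) (he : ∀ j, sympWeight (e j) ≤ t) :
    IsCorrectable (codeProjector (signedGenOps gen s)) (fun j => toOperator (e j)) := by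
  obtain ⟨hso, -, hmin, -⟩ := hS
  exact isCorrectable_toOperator_of_sympWeight_le (hspan ▸ hso) s (hspan ▸ hmin) ht he

/-- **CRSS Theorem 1 (existence form, as printed).** "Suppose `S̄` is an `(n − k)`-dimensional
linear subspace of `Ē` which is contained in its dual `S̄⊥` …, and is such that there are no
vectors of weight `≤ d − 1` in `S̄⊥ ∖ S̄`. Then there is a quantum-error-correcting code mapping
`k` qubits to `n` qubits which can correct `[(d − 1)/2]` errors": there are rows `gen` (any signs
`s` may be chosen; here `s = 0`) whose stabilizer code has dimension `2^k` and corrects every family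
of Pauli errors of weight `≤ t` with `2t < d`. (proved)
[cite: CalderbankEtAl1998, §2 Thm. 1 (printed p. 4)] -/
theorem IsAdditiveCode.exists_stabilizerCode {S : Submodule (ZMod 2) (SympVec n)}
    (hS : IsAdditiveCode S k d) :
    ∃ gen : Fin (n - k) → SympVec n, Submodule.span (ZMod 2) (Set.range gen) = S ∧
      Module.finrank ℂ (codeSpace (signedGenOps gen 0)) = 2 ^ k ∧
      ∀ (m t : ℕ) (e : Fin m → SympVec n), 2 * t < d → (∀ j, sympWeight (e j) ≤ t) →
        IsCorrectable (codeProjector (signedGenOps gen 0)) (fun j => toOperator (e j)) := by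
  obtain ⟨gen, hli, hspan⟩ := hS.exists_rows
  exact ⟨gen, hspan, hS.finrank_codeSpace hli hspan 0,
    fun m t e ht he => hS.isCorrectable_of_sympWeight_le hspan 0 ht he⟩

/-! ### In the numerical vocabulary of `StabilizerDistance.lean` (type-02: `logicalDim`, `minDistance`) -/

/-- `dim V_S = 2^k` with `k = logicalDim S̄ = n − dim S̄`, for any independent rows spanning a
self-orthogonal `S̄` and any signs. [cite: NielsenChuang2010, §10.5.1 Prop. 10.5] [cite: CalderbankEtAl1998, §2 Thm. 1 (printed p. 4)] -/
theorem finrank_codeSpace_eq_two_pow_logicalDim {S : Submodule (ZMod 2) (SympVec n)}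
    (hS : IsSelfOrthogonal S) {gen : Fin r → SympVec n} (hli : LinearIndependent (ZMod 2) gen)
    (hspan : Submodule.span (ZMod 2) (Set.range gen) = S) (s : Fin r → ZMod 2) :
    Module.finrank ℂ (codeSpace (signedGenOps gen s)) = 2 ^ logicalDim S := by
  have hdim := finrank_add_logicalDim hS
  have hr : r = Module.finrank (ZMod 2) S := by
    rw [← hspan, finrank_span_eq_card hli, Fintype.card_fin]
  refine finrank_codeSpace_eq_two_pow (hspan ▸ hS) hli ?_ s
  omega

/-- `2t < minDistance S̄` ⇒ every family of Pauli errors of weight `≤ t` is correctable by the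
stabilizer code of rows spanning the self-orthogonal `S̄` (any signs) — "a code with distance at
least `2t + 1` is able to correct errors on up to `t` qubits".
[cite: NielsenChuang2010, §10.3.1 p. 444 and §10.5.5 Thm 10.8 p. 467] [cite: CalderbankEtAl1998, §2 Thm. 1 (printed p. 4)] -/
theorem isCorrectable_toOperator_of_lt_minDistance {S : Submodule (ZMod 2) (SympVec n)}
    (hS : IsSelfOrthogonal S) {gen : Fin r → SympVec n}
    (hspan : Submodule.span (ZMod 2) (Set.range gen) = S) (s : Fin r → ZMod 2) {ι : Type*} [Fintype ι]
    {e : ι → SympVec n} {t : ℕ} (ht : 2 * t < minDistance S) (he : ∀ j, sympWeight (e j) ≤ t) :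
    IsCorrectable (codeProjector (signedGenOps gen s)) (fun j => toOperator (e j)) :=
  isCorrectable_toOperator_of_sympWeight_le (hspan ▸ hS) s (hspan ▸ hasMinDist_minDistance S) ht he

/-! ### CRSS Lemma 1 / Gottesman §3.2: the correction criterion is an equivalence -/

/-- **CRSS Lemma 1 (iff).** "An additive quantum-error-correcting code `Q` with associated space `S̄`
can correct a set of errors `Σ ⊆ E` precisely when `ē₁⁻¹ē₂ ∉ S̄⊥ ∖ S̄` for all `e₁, e₂ ∈ Σ`"
(Gottesman §3.2: "This code will correct any set of errors `{E_i}` iff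
`E_a E_b ∈ S ∪ (𝒢 − N(S))` for all `E_a, E_b`"). For independent self-orthogonal rows (any signs)
and Pauli errors `E(e_j)`: `IsCorrectable` (a trace-preserving recovery exists, NC Thm 10.1)
`↔ ∀ j k, e_j + e_k ∈ S̄ ∨ e_j + e_k ∉ S̄⊥`. The "only if" direction is NEW here: by the necessity
half of the Knill–Laflamme theorem `P E_j†E_k P = α_jk P`, so `E(e_j + e_k)` is DETECTED, which by
Gottesman's detection criterion (`detects_toOperator_iff_of_linearIndependent`) excludes
`e_j + e_k ∈ S̄⊥ ∖ S̄`. (proved)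
[cite: CalderbankEtAl1998, §2 Lemma 1 (printed p. 6)] [cite: Gottesman1997, §3.2] -/
theorem isCorrectable_toOperator_iff_of_linearIndependent {gen : Fin r → SympVec n}
    (hS : IsSelfOrthogonal (Submodule.span (ZMod 2) (Set.range gen)))
    (hli : LinearIndependent (ZMod 2) gen) (s : Fin r → ZMod 2) {ι : Type*} [Fintype ι]
    (e : ι → SympVec n) :
    IsCorrectable (codeProjector (signedGenOps gen s)) (fun j => toOperator (e j)) ↔
      ∀ j k, e j + e k ∈ Submodule.span (ZMod 2) (Set.range gen) ∨
        e j + e k ∉ sympDual (Submodule.span (ZMod 2) (Set.range gen)) := by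
  refine ⟨fun h j k => ?_, isCorrectable_toOperator_of_forall_mem_or_not_mem_sympDual hS s⟩
  have hg := isStabilizerGeneratorFamily_signedGenOps (sympInner_eq_zero_of_isSelfOrthogonal hS) s
  obtain ⟨α, -, hα⟩ := (isCorrectable_iff_knillLaflammeCondition (isHermitian_codeProjector hg)
    (codeProjector_mul_self hg) _).mp h
  have hjk := hα j k
  dsimp only at hjk
  rw [Matrix.mul_assoc (codeProjector _), conjTranspose_toOperator, toOperator_mul, Matrix.mul_smul,
    Matrix.smul_mul] at hjk
  have hφ := stringPhase_ne_zero (toPauliString (e j)) (toPauliString (e k))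
  have hdet : Detects (codeProjector (signedGenOps gen s)) (toOperator (e j + e k)) := by
    refine ⟨(stringPhase (toPauliString (e j)) (toPauliString (e k)))⁻¹ * α j k, ?_⟩
    rw [mul_smul, ← hjk, inv_smul_smul₀ hφ]
  exact (detects_toOperator_iff_of_linearIndependent hS hli s _).mp hdet

/-- **CRSS Lemma 1 for an `[[n,k,d]]` additive code** (rows = any basis of `S̄`): the stabilizer code
corrects the Pauli errors `E(e_j)` iff `e_j + e_k ∉ S̄⊥ ∖ S̄` for all `j, k`. (proved)
[cite: CalderbankEtAl1998, §2 Lemma 1 (printed p. 6)] -/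
theorem IsAdditiveCode.isCorrectable_iff {S : Submodule (ZMod 2) (SympVec n)} (hS : IsAdditiveCode S k d)
    {gen : Fin r → SympVec n} (hli : LinearIndependent (ZMod 2) gen)
    (hspan : Submodule.span (ZMod 2) (Set.range gen) = S) (s : Fin r → ZMod 2) {ι : Type*} [Fintype ι]
    (e : ι → SympVec n) :
    IsCorrectable (codeProjector (signedGenOps gen s)) (fun j => toOperator (e j)) ↔
      ∀ j k, e j + e k ∈ S ∨ e j + e k ∉ sympDual S := by
  have h := isCorrectable_toOperator_iff_of_linearIndependent (hspan ▸ hS.1) hli s e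
  rwa [hspan] at h

end Literature.InformationTheory.QuantumCodes
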